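import Literature.Probability.Percolation.TriSandpileDomain
import Literature.Probability.Percolation.TriMarkedRingLocal
import Literature.Probability.Percolation.TriMarkedDomainOfDartsStretch
import HarnessLib

/-!
# The sandpile class, III: marked sandpiles and their boundary mid-edges («SANDPILE-LAWPOINTS»)

Topic `Literature/Probability/Percolation`; family `crit-perc` / marked-loop lineage; the (G0b) GLUE of HOME `pub-sawmu-b-engine-2/gen23/DESIGN-next-gen23.md` §2: «SANDPILE-DOMAIN»
(`TriMarkedDomain.ofSandpile`), «TRI-MARK-DARTS» (`ofDarts`), «RING-LOCAL» (`isMarkable_of_ring`, `ArcPoint.ofRing`), «STRETCH-OF-DARTS» (arcs by visit time) put together: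

* ★ `Sandpile.isMarkable_lowerDart` — for a cell `g` of a sandpile whose left neighbour `g + e₃` is a cell and whose two lower neighbours `g + e₄`, `g + e₅` are not, the LOWER DART
  `(g, g + e₅)` is markable (the anticlockwise walk passes under `g` from left to right: `g + e₄` first, `g + e₅` second);
* ★★★ `TriMarkedDomain.ofSandpileDarts` — **a sandpile marked at any `k ≥ 1` markable boundary darts with distinct tails is a `k`-marked discrete domain** (`ofSandpile` then `ofDarts`);
  `ofSandpileDarts_verts`, `ofSandpileDarts_markDart_mem`, `exists_ofSandpileDarts_markDart_eq`;
* ★ `Sandpile.arcPoint_of_lowerDart` — a boundary mid-edge on the arc `A_a` at the lower dart `(g, g + e₄)` of a cell `g` with `g + e₃`, `g + e₅` cells (a flat bottom edge), whenever that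
  dart lies on the stretch `A_a` (membership decided by «STRETCH-OF-DARTS»).

So every «lawpoint of the tame family» of the BSPAN programme (HOME `FINDING-BSPAN-SLIDE-INDUCTION.md` §4) is now a term: `(TriMarkedDomain.ofSandpileDarts …, Sandpile.arcPoint_of_lowerDart …)`.

## References
* B. Bollobás, O. Riordan, *Percolation*, Cambridge University Press (2006), Ch. 7 §7.2.2 pp. 168–169 (discrete domains, marked sites at the second outside neighbour, arcs).
* M. Khristoforov, S. Smirnov, *Percolation and O(1) loop model*, arXiv:2111.15612 (2021), §2 eq. (4) and Remark 6 (arXiv v1 p. 5: `z` on a boundary arc).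

## Mathlib / tree
Tree: `TriSandpileDomain` (`TriMarkedDomain.ofSandpile`, `ofSandpile_verts`), `TriSandpileOneBlock` (`sandpile`, `IsPile`), `TriMarkedDomainOfDarts` (`ofDarts`, `IsMarkable`,
`ofDarts_markDart_mem`, `exists_ofDarts_markDart_eq`), `TriMarkedRingLocal` (`isMarkable_of_ring`, `MarkedLoops.ArcPoint.ofRing`), `MarkedLoopBoundarySpan` (`ArcPoint`).
-/

noncomputable section

open Finset Literature.Probability.LatticeModels

namespace Literature.Probability.Percolation

namespace Sandpile

variable {L : ℕ} {P : Finset (Site 2)}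

/-- Auxiliary `Fin 6` facts. [cite: BollobasRiordan2006, Ch. 7 §7.2.2 p. 168; lane plumbing] -/
private theorem fin6_marks : (4 : Fin 6) + 5 = 3 ∧ (4 : Fin 6) + 1 = 5 := by decide

/-- ★ **the lower dart `(g, g + e₅)` of a cell with a left neighbour and a free bottom is MARKABLE.** [cite: BollobasRiordan2006, Ch. 7 §7.2.2 p. 169 (marked at the second outside neighbour)] -/
theorem isMarkable_lowerDart {g : Site 2} (hg : g ∈ sandpile L P) (hleft : g + triDir 3 ∈ sandpile L P) (h4 : g + triDir 4 ∉ sandpile L P)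
    (h5 : g + triDir 5 ∉ sandpile L P) : IsMarkable (sandpile L P) (g, g + triDir 5) := by
  have h := isMarkable_of_ring (G := sandpile L P) (g := g) 4 hg (by rw [fin6_marks.1]; exact hleft) h4 (by rw [fin6_marks.2]; exact h5)
  rwa [fin6_marks.2] at h

end Sandpile

namespace TriMarkedDomain

variable {L : ℕ} {P : Finset (Site 2)} (hP : Sandpile.IsPile L P) (hL : 2 ≤ L) {k : ℕ}

/-- ★★★ **A SANDPILE MARKED AT ANY SET OF MARKABLE DARTS IS A `k`-MARKED DISCRETE DOMAIN.** [cite: BollobasRiordan2006, Ch. 7 §7.2.2 pp. 168–169] -/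
def ofSandpileDarts (hk : 0 < k) (S : Finset (Site 2 × Site 2)) (hcard : #S = k) (hS : ∀ d ∈ S, IsMarkable (Sandpile.sandpile L P) d)
    (hinj : Set.InjOn Prod.fst (S : Set (Site 2 × Site 2))) : TriMarkedDomain k :=
  (TriMarkedDomain.ofSandpile hP hL).ofDarts hk S hcard (fun d hd => by rw [Sandpile.ofSandpile_verts]; exact hS d hd) hinj

/-- its site set is the sandpile. [cite: BollobasRiordan2006, Ch. 7 §7.2.2 p. 168; lane plumbing] -/
@[simp] theorem ofSandpileDarts_verts (hk : 0 < k) (S : Finset (Site 2 × Site 2)) (hcard : #S = k) (hS) (hinj) :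
    (ofSandpileDarts hP hL hk S hcard hS hinj).verts = Sandpile.sandpile L P := rfl

/-- every marked dart is a dart of `S`. [cite: BollobasRiordan2006, Ch. 7 §7.2.2 p. 169] -/
theorem ofSandpileDarts_markDart_mem (hk : 0 < k) (S : Finset (Site 2 × Site 2)) (hcard : #S = k) (hS : ∀ d ∈ S, IsMarkable (Sandpile.sandpile L P) d)
    (hinj) (i : Fin k) : (ofSandpileDarts hP hL hk S hcard hS hinj).markDart i ∈ S :=
  (TriMarkedDomain.ofSandpile hP hL).ofDarts_markDart_mem hk S hcard _ hinj i

/-- every dart of `S` is a marked dart. [cite: BollobasRiordan2006, Ch. 7 §7.2.2 p. 169] -/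
theorem exists_ofSandpileDarts_markDart_eq (hk : 0 < k) (S : Finset (Site 2 × Site 2)) (hcard : #S = k) (hS : ∀ d ∈ S, IsMarkable (Sandpile.sandpile L P) d)
    (hinj) {d : Site 2 × Site 2} (hd : d ∈ S) : ∃ i : Fin k, (ofSandpileDarts hP hL hk S hcard hS hinj).markDart i = d :=
  (TriMarkedDomain.ofSandpile hP hL).exists_ofDarts_markDart_eq hk S hcard _ hinj hd

end TriMarkedDomain

namespace Sandpile

open MarkedLoops

variable {L : ℕ} {P : Finset (Site 2)}

/-- ★ **a boundary mid-edge at a flat lower dart**: for a marked domain `D` whose site set is a sandpile, a cell `g` with cells at `g + e₃` and `g + e₅` and the lower dart `(g, g + e₄)` on the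
stretch `A_a` give an `ArcPoint D a` (read at the face left of the dart). [cite: KhristoforovSmirnov2021, §2 eq. (4) and Remark 6 (arXiv v1 p. 5); BollobasRiordan2006, Ch. 7 §7.2.2 pp. 191–195] -/
def arcPoint_of_lowerDart {nm : ℕ} {D : TriMarkedDomain nm} (hD : D.verts = sandpile L P) {a : Fin nm} {g : Site 2}
    (hd : (g, g + triDir 4) ∈ D.stretch a) (h5 : g + triDir 5 ∈ sandpile L P) (h3 : g + triDir 3 ∈ sandpile L P) : ArcPoint D a :=
  ArcPoint.ofRing 4 hd (by rw [hD, show (4 : Fin 6) + 1 = 5 by decide]; exact h5) (by rw [hD, show (4 : Fin 6) + 5 = 3 by decide]; exact h3)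

end Sandpile

end Literature.Probability.Percolation
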